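import Literature.NumberTheory.Automorphic.HeckeLocalSumOnForms
import Literature.NumberTheory.Automorphic.SmoothProjector
import HarnessLib

/-!
# `K(𝔫)`-invariant representatives modulo `W'`, and the local Hecke sum on `(W / W')^{K(𝔫)}`

Topic `NumberTheory/Automorphic`; namespace `Literature.NumberTheory.Automorphic.AutomorphicRepData`.
Theorems only (no definition, no named fact, no `sorry`); sequel to `HeckeLocalSumOnForms`.

For an automorphic representation `π = W / W'` of `GL_n(𝔸_K)` (Borel–Jacquet model):

* `isSmoothVector_of_mem_W` — forms of `W` are smooth vectors for the finite-adelic right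
  translation `r ∘ GLn.ofFinite` (each has an open level; Borel–Jacquet 4.2 (a));
* `exists_fixed_sub_mem` — **invariant representatives**: if `ψ ∈ W` is `K(𝔫)`-invariant MODULO
  `W'` (`r(u) ψ - ψ ∈ W'`, `u ∈ K(𝔫)`, `𝔫 ≠ 0`) then `ψ ≡ ψ' (mod W')` for a `K(𝔫)`-INVARIANT
  `ψ' ∈ W`, namely the average of `ψ` over the compact open `K_f(𝔫)` (`SmoothProjector.avg`,
  computed as the finite average `[K_f(𝔫) : B]⁻¹ ∑_q r(q̃) ψ` over the stabiliser `B` of `ψ`;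
  Bernstein–Zelevinsky §2.3, Bump §4.2); i.e. `(W / W')^{K(𝔫)}` is the image of `W^{K(𝔫)}`;
* `exists_hasSatakeParamAt_and_sum_rightTranslation_sub_smul_mem_of_sub_mem` — consequently, under
  the tree's per-`π` named fact `Flath1979_heckeOperator_ofLocal_sub_smul_mem` (hypothesis `hS`),
  the local Hecke sum `A = ∑_{y ∈ s} r(ι_w y)` (`s` a transversal for `t_{w,j}(ϖ_w)`, `w ∤ 𝔫`)
  acts by the Satake eigenvalue `q_w^{j(n-j)/2} e_j(α)` on every `ψ ∈ W` that is `K(𝔫)`-invariant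
  modulo `W'` — **`A` is the scalar `q_w^{j(n-j)/2} e_j(α)` on `(W / W')^{K(𝔫)}`**, the input of
  the cohomological computation `CuspidalCohomologyHeckeLocal.heckeTWt_eq_rTensorCohomologyHom_sum`
  (Eichler–Shimura–Harder glue, Harder 1987, §3).

## References
* [Harder1987] G. Harder, *Eisenstein cohomology of arithmetic groups. The case GL₂*, §3.
* [BorelJacquetCorvallis1979] A. Borel, H. Jacquet, Corvallis 1979, §4.2 (a), §4.6.
* [FlathCorvallis1979] D. Flath, Corvallis 1979, Thm. 3.
-/

noncomputable section

namespace Literature.NumberTheory.Automorphic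

namespace AutomorphicRepData

open MulAction
open scoped MatrixGroups Classical
open scoped _root_.NumberField
open _root_.NumberField IsDedekindDomain

variable {n : ℕ} {K : Type} [Field K] [NumberField K] {hcpt : isCompact_glFiniteIntegralLevel n K}
  (π : AutomorphicRepData (AutomorphyDatum.gl n K hcpt))

/-- Forms of `W` are smooth vectors for the finite-adelic right translation `r ∘ GLn.ofFinite`
(each has an open level, `exists_isOpen_forall_rightTranslation_ofFinite_eq`).
[cite: BorelJacquetCorvallis1979, §4.2 (a)] -/
theorem isSmoothVector_of_mem_W {ψ : (AdelicGroupData.gl n K).Adelic → ℂ} (hψ : ψ ∈ π.W) :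
    Representation.IsSmoothVector
      ((rightTranslation (AdelicGroupData.gl n K)).comp (GLn.ofFinite n K)) ψ := by
  obtain ⟨U₀, hU₀, hfix⟩ :=
    exists_isOpen_forall_rightTranslation_ofFinite_eq (π.stable.le_automorphicForms hψ)
  refine Subgroup.isOpen_mono (H₁ := U₀) (fun u hu => ?_) hU₀
  rw [Representation.mem_stabilizerSubgroup]
  exact hfix u hu

/-- **Invariant representatives modulo `W'`.** If `ψ ∈ W` is `K(𝔫)`-invariant modulo `W'`
(`r(u) ψ - ψ ∈ W'` for `u ∈ K(𝔫)`, `𝔫 ≠ 0`), then `ψ ≡ ψ' (mod W')` for a `K(𝔫)`-INVARIANT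
`ψ' ∈ W`: the average of `ψ` over the compact open `K_f(𝔫)` (`SmoothProjector.avg`, a finite
average `[K_f(𝔫) : B]⁻¹ ∑_{q} r(q̃) ψ`). [cite: BorelJacquetCorvallis1979, §4.6] [folklore] -/
theorem exists_fixed_sub_mem {𝔫 : Ideal (𝓞 K)} (h𝔫 : 𝔫 ≠ 0)
    {ψ : (AdelicGroupData.gl n K).Adelic → ℂ} (hψW : ψ ∈ π.W)
    (hψ : ∀ u ∈ principalCongruenceLevel n K 𝔫,
      rightTranslation (AdelicGroupData.gl n K) u ψ - ψ ∈ π.W') :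
    ∃ ψ' ∈ π.W, (∀ u ∈ principalCongruenceLevel n K 𝔫,
        rightTranslation (AdelicGroupData.gl n K) u ψ' = ψ') ∧ ψ' - ψ ∈ π.W' := by
  set r := rightTranslation (AdelicGroupData.gl n K) with hr
  set rf : Representation ℂ (GL (Fin n) (FiniteAdeleRing (𝓞 K) K))
      ((AdelicGroupData.gl n K).Adelic → ℂ) := r.comp (GLn.ofFinite n K) with hrf
  set H : Subgroup (GL (Fin n) (FiniteAdeleRing (𝓞 K) K)) :=
    (principalCongruenceLevel n K 𝔫).comap (GLn.ofFinite n K) with hH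
  have hHc : IsCompact (H : Set (GL (Fin n) (FiniteAdeleRing (𝓞 K) K))) :=
    isCompact_comap_ofFinite_principalCongruenceLevel n K h𝔫
  have hsm : Representation.IsSmoothVector rf ψ := π.isSmoothVector_of_mem_W hψW
  haveI := SmoothProjector.finiteIndex_stabIn (ρ := rf) (H := H) hHc hsm
  haveI : Fintype (H ⧸ SmoothProjector.stabIn rf H ψ) := Fintype.ofFinite _
  refine ⟨SmoothProjector.avg rf H ψ, ?_, fun u hu => ?_, ?_⟩
  · -- `avg ∈ W`: a finite linear combination of finite-adelic translates of `ψ`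
    rw [SmoothProjector.avg_eq_stabIn, finsum_eq_sum_of_fintype]
    refine π.W.smul_mem _ (π.W.sum_mem fun q _ => ?_)
    exact π.stable.finite_stable _ ⟨(q.out : GL (Fin n) (FiniteAdeleRing (𝓞 K) K)), rfl⟩ hψW
  · -- `K(𝔫)`-invariance: `u = GLn.ofFinite (sndHom u)` with `sndHom u ∈ K_f(𝔫)`
    have hfixf := SmoothProjector.avg_mem_fixedPoints (ρ := rf) (H := H) hHc hsm
    rw [Representation.mem_fixedPoints] at hfixf
    have hu' : GLn.sndHom n K u ∈ H := by
      rw [hH, Subgroup.mem_comap, GLn.ofFinite_sndHom_of_mem (principalCongruenceLevel_le n K 𝔫 hu)]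
      exact hu
    have h := hfixf _ hu'
    have e : r u = rf (GLn.sndHom n K u) :=
      congrArg r (GLn.ofFinite_sndHom_of_mem (principalCongruenceLevel_le n K 𝔫 hu)).symm
    rw [e]
    exact h
  · -- `avg - ψ ∈ W'`: `[H:B]⁻¹ ∑_q (r(q̃) ψ - ψ)`
    rw [SmoothProjector.avg_eq_stabIn, finsum_eq_sum_of_fintype]
    have hidx : (((SmoothProjector.stabIn rf H ψ).index : ℕ) : ℂ) ≠ 0 := by
      rw [Nat.cast_ne_zero]
      exact Subgroup.FiniteIndex.index_ne_zero
    have hcard : (Finset.univ : Finset (H ⧸ SmoothProjector.stabIn rf H ψ)).card =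
        (SmoothProjector.stabIn rf H ψ).index := by
      rw [Finset.card_univ, Subgroup.index_eq_card, Nat.card_eq_fintype_card]
    have hsum : ∑ q : H ⧸ SmoothProjector.stabIn rf H ψ,
        (rf (q.out : GL (Fin n) (FiniteAdeleRing (𝓞 K) K)) ψ - ψ) ∈ π.W' :=
      π.W'.sum_mem fun q _ => hψ _ (q.out : H).2
    have heq : (((SmoothProjector.stabIn rf H ψ).index : ℕ) : ℂ)⁻¹ •
        ∑ q : H ⧸ SmoothProjector.stabIn rf H ψ,
          rf (q.out : GL (Fin n) (FiniteAdeleRing (𝓞 K) K)) ψ - ψ =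
        (((SmoothProjector.stabIn rf H ψ).index : ℕ) : ℂ)⁻¹ •
          ∑ q : H ⧸ SmoothProjector.stabIn rf H ψ,
            (rf (q.out : GL (Fin n) (FiniteAdeleRing (𝓞 K) K)) ψ - ψ) := by
      rw [Finset.sum_sub_distrib, Finset.sum_const, hcard, smul_sub, ← Nat.cast_smul_eq_nsmul ℂ,
        smul_smul, inv_mul_cancel₀ hidx, one_smul]
    rw [heq]
    exact π.W'.smul_mem _ hsum

/-- **The sum of local translations on forms invariant modulo `W'`.** Under the named fact, for
`𝔫 ≠ 0`, a `K(𝔫)`-invariant `φ ∈ W ∖ W'`, `w ∤ 𝔫`: there is a Satake parameter `α` of `π` at `w`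
such that for all `j ≤ n`, every transversal `s` for `t_{w,j}(ϖ_w)` and every `ψ ∈ W` that is
`K(𝔫)`-invariant MODULO `W'`, `∑_{y ∈ s} r(ι_w y) ψ ≡ q_w^{j(n-j)/2} e_j(α) ψ (mod W')` — i.e.
the operator `A = ∑_{y ∈ s} r(ι_w y)` acts by the Satake eigenvalue on `(W / W')^{K(𝔫)}`.
[cite: FlathCorvallis1979, Thm. 3] [cite: Harder1987, §3] -/
theorem exists_hasSatakeParamAt_and_sum_rightTranslation_sub_smul_mem_of_sub_mem
    (hS : π.Flath1979_heckeOperator_ofLocal_sub_smul_mem) {𝔫 : Ideal (𝓞 K)} (h𝔫 : 𝔫 ≠ 0)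
    {w : HeightOneSpectrum (𝓞 K)} (hw : ¬ w.asIdeal ∣ 𝔫)
    {φ : (AdelicGroupData.gl n K).Adelic → ℂ} (hφW : φ ∈ π.W) (hφW' : φ ∉ π.W')
    (hfix : ∀ u ∈ principalCongruenceLevel n K 𝔫,
      rightTranslation (AdelicGroupData.gl n K) u φ = φ) :
    ∃ α : Multiset ℂ, π.HasSatakeParamAt w α ∧ ∀ j ≤ n,
      ∀ (s : Finset (GL (Fin n) (w.adicCompletion K))),
        Set.BijOn
          (fun y : GL (Fin n) (w.adicCompletion K) =>
            (y : GL (Fin n) (w.adicCompletion K) ⧸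
              (valuedCongruenceSubgroup (Fin n) (1 : WithZero (Multiplicative ℤ)) :
                Subgroup (GL (Fin n) (w.adicCompletion K)))))
          s (orbit (valuedCongruenceSubgroup (Fin n) (1 : WithZero (Multiplicative ℤ)) :
              Subgroup (GL (Fin n) (w.adicCompletion K)))
            ((glDiagonal n (w.adicCompletion K) fun k =>
                if (k : ℕ) < j then BigHeckeGLn.uniformizerAt w else 1 :
                  GL (Fin n) (w.adicCompletion K)) :
              GL (Fin n) (w.adicCompletion K) ⧸
                (valuedCongruenceSubgroup (Fin n) (1 : WithZero (Multiplicative ℤ)) :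
                  Subgroup (GL (Fin n) (w.adicCompletion K))))) →
        ∀ ψ ∈ π.W, (∀ u ∈ principalCongruenceLevel n K 𝔫,
            rightTranslation (AdelicGroupData.gl n K) u ψ - ψ ∈ π.W') →
          (∑ y ∈ s, rightTranslation (AdelicGroupData.gl n K) (GLn.ofLocal n K w y) ψ) -
            (((Real.sqrt (w.residueCard : ℝ) : ℝ) : ℂ) ^ (j * (n - j)) * α.esymm j) • ψ ∈ π.W' := by
  obtain ⟨α, hα, hT⟩ :=
    π.exists_hasSatakeParamAt_and_sum_rightTranslation_sub_smul_mem hS h𝔫 hw hφW hφW' hfix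
  refine ⟨α, hα, fun j hj s hs ψ hψW hψ => ?_⟩
  obtain ⟨ψ', hψ'W, hψ'fix, hψ'⟩ := π.exists_fixed_sub_mem h𝔫 hψW hψ
  set c : ℂ := ((Real.sqrt (w.residueCard : ℝ) : ℝ) : ℂ) ^ (j * (n - j)) * α.esymm j with hc
  have h1 := hT j hj s hs ψ' hψ'W hψ'fix
  -- `A (ψ - ψ') ∈ W'` and `c (ψ - ψ') ∈ W'`
  have h2 : ∑ y ∈ s, rightTranslation (AdelicGroupData.gl n K) (GLn.ofLocal n K w y) (ψ' - ψ) ∈ π.W' :=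
    π.W'.sum_mem fun y _ => π.stable'.finite_stable _
      ⟨BigHeckeGLn.ofLocal n K w y, GLn.ofFinite_sndHom_ofLocal w y⟩ hψ'
  have h3 : c • (ψ' - ψ) ∈ π.W' := π.W'.smul_mem c hψ'
  have key : (∑ y ∈ s, rightTranslation (AdelicGroupData.gl n K) (GLn.ofLocal n K w y) ψ) - c • ψ =
      ((∑ y ∈ s, rightTranslation (AdelicGroupData.gl n K) (GLn.ofLocal n K w y) ψ') - c • ψ') -
        (∑ y ∈ s, rightTranslation (AdelicGroupData.gl n K) (GLn.ofLocal n K w y) (ψ' - ψ)) +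
          c • (ψ' - ψ) := by
    simp only [map_sub, Finset.sum_sub_distrib, smul_sub]
    abel
  rw [key]
  exact π.W'.add_mem (π.W'.sub_mem h1 h2) h3

end AutomorphicRepData

end Literature.NumberTheory.Automorphic

end
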